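import Mathlib
import HarnessLib
import Summits.HubbardSuperconductivity.HubbardSuperconductivity.Theorems.KLProgrammeKLRegimeSectorSliceAlphaWtRows
import Summits.HubbardSuperconductivity.HubbardSuperconductivity.Theorems.KLProgrammeKLRegimeSectorSliceRowsMomentGeneric

/-!
# Route `KLProgramme` — VL child `KLRegimeVolumeLimitV17F2` (stmt-HubbardSuperconductivity-20440), closer MODEL file M2 «MISMATCH-SLICE», part 1:
# the `klScaleWt`-weighted row / column sums and the entry sup of the sectorised FRAME DEFECT of the counterterm slice covariance,
# `S(F)ᵀ·(C^{K′}_{(Λ,Λ′]} − C^{K}_{(Λ,Λ′]})·S(F)`, reduce to weighted per-pair character sums of the slice-symbol INCREMENT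

Cell `gate-hubbard-kl`, seat hubbard-kl-k3c4-p2 (g11; UV / Matsubara all-U lane), ask «MISMATCH-SLICE» (= M2) of the VL registrant
k3c4-p1 g11 (KL STATUS 2026-08-27 21:51Z, blueprint v4 `VL-INDUCTION-BLUEPRINT-g11.md` §3, brackets (a)/(b); pen ruling (R75)).
In the own-top-frame organisation of the inductive two-volume comparison (`stub_vl_nestedFramed`, skeleton «cauchy» v9) the fine volume's
sector-pulled-back slice covariance at its own top frame `K″ = K_{n⋆}^{(L″,M)}` is compared, at every scale `1 ≤ j ≤ n⋆`, with the one at the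
coarse volume's top frame `K = K_{n⋆}^{(L,M)}`; the difference is the sectorised NORMAL covariance with symbol the torus increment
`Ψ̂_ω(e_{K′}(k⃗)) − Ψ̂_ω(e_K(k⃗))` (`TorusFourierL2.hubbardCovSliceCT_sub_eq_normalCovariance`, k3c3-p2).  This file is the DEFECT twin of
p3's `…EngineScaleWtSliceRows` §2 / `…SectorSliceAlphaWtRows` (pure bookkeeping, generic in the two frames `K, K′` and in the sector family `F`,
which may live on a THIRD frame):

* §1 **`rowSum_klScaleWt_sliceCT_sub_le`** / **`colSum_klScaleWt_sliceCT_sub_le`** — for `D := Sᵀ(F)·(C^{K′}_{(Λ,Λ′]} − C^{K}_{(Λ,Λ′]})·S(F)`,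
  `Σ_{Y′} ‖D Y Y′‖·klScaleWt L M β n {pos Y, pos Y′} ≤ 8·Σ_{ω′} T^Δ_{w_n}(ω,ω′)` with the moment weight
  `w_n(z) = 1 + (Λ_nβ/(2M))|z̃₁| + Λ_n|z̃₂,₁| + Λ_n|z̃₂,₂|` and `T^Δ_w(ω,ω′)` the `w`-weighted `ℓ¹` norm of the character sum with symbol
  `(βL²)⁻²·F_ω F_{ω′}·(Ψ̂[K′] − Ψ̂[K])` — EXACTLY the left-hand side of k3c3-p2's increment pair lemma
  `…SectorSliceIncrPairMoment.sliceIncrPairWt_charSum_l1_le` (after `momentWt_le_mul_rateWt`);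
* §2 **`rowSumWt_sliceCT_sub_le_alpha`** / **`colSumWt_sliceCT_sub_le_alpha`** — `≤ 8·novl·T_max` from per-pair bounds on adjacent pairs and an
  overlap count (twin of `rowSumWt_norm_pullback_sliceCT_le_alpha`);
* §3 **`rowSumWt_sliceCT_sub_bgmFat_le_of_pairBound`** / **`colSumWt_sliceCT_sub_bgmFat_le_of_pairBound`** — the FAT family
  `F̃ = bgmFatMultiplier … (nambuXiCT L μ K_F) (m+1)` on ANY frame `K_F` (overlap count `9`, `card_overlap_bgmFat_le_nine`): from a UNIFORM
  rate-weighted per-pair increment bound `T_max` and the weight domination `Λ_{nw}β/(2M) ≤ D s₀`, `Λ_{nw} ≤ D s₁`, `1 ≤ D`: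
  `≤ 8·(9·(D·T_max))` — the `hrow/hcol` shape of the one-frame instance `rowSumWt_sliceCT_bgmFat_le_of_pairBound`, so the consumer discharges
  the defect bracket with the SAME `D` and rates as the slice rows themselves;
* §4 **`norm_apply_le_of_rowSumWt`**, **`rowSum_norm_le_of_rowSumWt`**, **`colSum_norm_le_of_colSumWt`** — entry sup (bracket (a)) and plain row / column sums from the weighted
  ones (`1 ≤ klScaleWt`).

Everything is proved; no definitions, no named facts; nothing is asserted about the model.  Part 2 (`…SectorSliceDefectPairFat`) supplies the
uniform per-pair increment bound for the fat pair with every term carrying the band increment `|e_{K′} − e_K|_{C³}`, part 3 the tower instance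
at the two volumes' top flow frames (`…TwoVolumeFrameDefect` twin). [folklore]

References: G. Benfatto, A. Giuliani, V. Mastropietro, Ann. Henri Poincaré 7 (2006) 809–898, §2.7 (2.66)–(2.67), §2.8 (2.81), §3 (3.3).
-/

noncomputable section

namespace Summit.HubbardSuperconductivity.HubbardSuperconductivity.Theorems.TorusFourierL2

set_option linter.dupNamespace false -- summit = problem name (single-conjunct summit), D-0017

open Finset Complex Literature.MathematicalPhysics.QuantumLattice Literature.Probability.LatticeModels
open Summit.HubbardSuperconductivity.HubbardSuperconductivity.Theorems.KLRegimeSplit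
open Summit.HubbardSuperconductivity.HubbardSuperconductivity.Theorems.KLProgrammeLegKernels
open Summit.HubbardSuperconductivity.HubbardSuperconductivity.Theorems.EngineV8
open scoped Real

/-! ## §1 The `klScaleWt`-weighted rows / columns of the sectorised slice defect reduce to weighted per-pair increment sums -/

section Generic

variable {L M N : ℕ} [NeZero L] [NeZero M]

/-- **`hrow` of the slice DEFECT in `klScaleWt` currency**: for `D = Sᵀ(F)·(C^{K′}_{(Λ,Λ′]} − C^{K}_{(Λ,Λ′]})·S(F)`, `0 < β`, every scale `n` and
every lattice leg `Y = (x, ((ω,σ),c))`,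
`Σ_{Y′} ‖D Y Y′‖·klScaleWt L M β n {pos Y, pos Y′} ≤ 8·Σ_{ω′} Σ_z w_n(z)·‖Σ_q χ_{q₁}(z₁)χ_{q₂}(z₂) • G^Δ_{ωω′}(q)‖`,
`G^Δ_{ωω′}(q) = (βL²)⁻²·F_ω(k_q)F_{ω′}(k_q)·(Ψ̂_{ω(q₁)}(e_{K′}(q₂)) − Ψ̂_{ω(q₁)}(e_K(q₂)))`.
[cite: BenfattoGiulianiMastropietro2006, §2.7 (2.66)–(2.67), §3 (3.3)] -/
theorem rowSum_klScaleWt_sliceCT_sub_le {β : ℝ} (hβ : 0 < β) (μ : ℝ) (K K' : TrigPolyC4v) (Λ Λ' : ℝ) (n : ℕ)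
    (F : Fin N → FreqMomentum L M → ℂ) (Y : SpaceTimeIdx L M × SectorLeg N) :
    ∑ Y' : SpaceTimeIdx L M × SectorLeg N,
        ‖((sectorSubMatrix L M β F).transpose * (hubbardCovSliceCT L M β μ 0 K' Λ Λ' - hubbardCovSliceCT L M β μ 0 K Λ Λ') *
            sectorSubMatrix L M β F) Y Y'‖ *
          klScaleWt L M β n {latticeLegPos (2 * (2 * M)) Y, latticeLegPos (2 * (2 * M)) Y'} ≤
      8 * ∑ ω' : Fin N, ∑ z : TorusSite 1 (2 * M) × TorusSite 2 L,
        (1 + klScale klE0 n * β / (2 * M) * |(((z.1 0).valMinAbs : ℤ) : ℝ)| + klScale klE0 n * |(((z.2 0).valMinAbs : ℤ) : ℝ)| +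
          klScale klE0 n * |(((z.2 1).valMinAbs : ℤ) : ℝ)|) *
        ‖∑ q : TorusSite 1 (2 * M) × TorusSite 2 L, (torusChar q.1 z.1 * torusChar q.2 z.2) •
          ((((1 / (β * (L : ℝ) ^ 2) : ℝ) : ℂ) ^ 2 *
            (F Y.2.1.1 (⟨(q.1 0).val, ZMod.val_lt (q.1 0)⟩, q.2) * F ω' (⟨(q.1 0).val, ZMod.val_lt (q.1 0)⟩, q.2) *
              (sliceSymbolFnXi (β * (L : ℝ) ^ 2) 0 Λ Λ' (matsubaraFreq β M ⟨(q.1 0).val, ZMod.val_lt (q.1 0)⟩) (nambuXiCT L μ K' q.2) -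
                sliceSymbolFnXi (β * (L : ℝ) ^ 2) 0 Λ Λ' (matsubaraFreq β M ⟨(q.1 0).val, ZMod.val_lt (q.1 0)⟩) (nambuXiCT L μ K q.2)))))‖ := by
  have hΛ : 0 ≤ klScale klE0 n := (klth_klScale_pos n).le
  have hs₀ : 0 ≤ klScale klE0 n * β / (2 * M) := by positivity
  -- the moment weight as a function on the product torus
  set w : TorusSite 1 (2 * M) × TorusSite 2 L → ℝ := fun z =>
    1 + klScale klE0 n * β / (2 * M) * |(((z.1 0).valMinAbs : ℤ) : ℝ)| + klScale klE0 n * |(((z.2 0).valMinAbs : ℤ) : ℝ)| +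
      klScale klE0 n * |(((z.2 1).valMinAbs : ℤ) : ℝ)| with hw
  have hw0 : ∀ z, 0 ≤ w z := fun z => momentWt_nonneg hs₀ hΛ z
  have hweven : ∀ a b, w (-a, -b) = w (a, b) := fun a b => by simp only [hw]; exact momentWt_neg _ _ a b
  -- the defect is the sectorised NORMAL covariance with the increment symbol
  rw [hubbardCovSliceCT_sub_eq_normalCovariance hβ.ne' μ K K' Λ Λ']
  have hrows := rowSumWt_norm_pullback_normalCovariance_le hβ.ne'
    (fun ω k => sliceSymbolFnXi (β * (L : ℝ) ^ 2) 0 Λ Λ' ω (nambuXiCT L μ K' k) -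
      sliceSymbolFnXi (β * (L : ℝ) ^ 2) 0 Λ Λ' ω (nambuXiCT L μ K k)) F w hw0 hweven Y
  refine le_trans (Finset.sum_le_sum fun Y' _ => mul_le_mul_of_nonneg_left ?_ (norm_nonneg _)) hrows
  -- the tree weight on the pair is below the moment weight at the difference
  have h := klScaleWt_pair_latticeLegPos_le (L := L) (M := M) hβ.le n Y Y'
  simp only [hw]
  exact h

/-- **`hcol` of the slice DEFECT in `klScaleWt` currency**: the column twin (the symbol read at the spin of `Y′`).
[cite: BenfattoGiulianiMastropietro2006, §2.7 (2.66)–(2.67), §3 (3.3)] -/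
theorem colSum_klScaleWt_sliceCT_sub_le {β : ℝ} (hβ : 0 < β) (μ : ℝ) (K K' : TrigPolyC4v) (Λ Λ' : ℝ) (n : ℕ)
    (F : Fin N → FreqMomentum L M → ℂ) (Y' : SpaceTimeIdx L M × SectorLeg N) :
    ∑ Y : SpaceTimeIdx L M × SectorLeg N,
        ‖((sectorSubMatrix L M β F).transpose * (hubbardCovSliceCT L M β μ 0 K' Λ Λ' - hubbardCovSliceCT L M β μ 0 K Λ Λ') *
            sectorSubMatrix L M β F) Y Y'‖ *
          klScaleWt L M β n {latticeLegPos (2 * (2 * M)) Y, latticeLegPos (2 * (2 * M)) Y'} ≤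
      8 * ∑ ω : Fin N, ∑ z : TorusSite 1 (2 * M) × TorusSite 2 L,
        (1 + klScale klE0 n * β / (2 * M) * |(((z.1 0).valMinAbs : ℤ) : ℝ)| + klScale klE0 n * |(((z.2 0).valMinAbs : ℤ) : ℝ)| +
          klScale klE0 n * |(((z.2 1).valMinAbs : ℤ) : ℝ)|) *
        ‖∑ q : TorusSite 1 (2 * M) × TorusSite 2 L, (torusChar q.1 z.1 * torusChar q.2 z.2) •
          ((((1 / (β * (L : ℝ) ^ 2) : ℝ) : ℂ) ^ 2 *
            (F ω (⟨(q.1 0).val, ZMod.val_lt (q.1 0)⟩, q.2) * F Y'.2.1.1 (⟨(q.1 0).val, ZMod.val_lt (q.1 0)⟩, q.2) *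
              (sliceSymbolFnXi (β * (L : ℝ) ^ 2) 0 Λ Λ' (matsubaraFreq β M ⟨(q.1 0).val, ZMod.val_lt (q.1 0)⟩) (nambuXiCT L μ K' q.2) -
                sliceSymbolFnXi (β * (L : ℝ) ^ 2) 0 Λ Λ' (matsubaraFreq β M ⟨(q.1 0).val, ZMod.val_lt (q.1 0)⟩) (nambuXiCT L μ K q.2)))))‖ := by
  have hΛ : 0 ≤ klScale klE0 n := (klth_klScale_pos n).le
  have hs₀ : 0 ≤ klScale klE0 n * β / (2 * M) := by positivity
  set w : TorusSite 1 (2 * M) × TorusSite 2 L → ℝ := fun z =>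
    1 + klScale klE0 n * β / (2 * M) * |(((z.1 0).valMinAbs : ℤ) : ℝ)| + klScale klE0 n * |(((z.2 0).valMinAbs : ℤ) : ℝ)| +
      klScale klE0 n * |(((z.2 1).valMinAbs : ℤ) : ℝ)| with hw
  have hw0 : ∀ z, 0 ≤ w z := fun z => momentWt_nonneg hs₀ hΛ z
  have hweven : ∀ a b, w (-a, -b) = w (a, b) := fun a b => by simp only [hw]; exact momentWt_neg _ _ a b
  rw [hubbardCovSliceCT_sub_eq_normalCovariance hβ.ne' μ K K' Λ Λ']
  have hcols := colSumWt_norm_pullback_normalCovariance_le hβ.ne'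
    (fun ω k => sliceSymbolFnXi (β * (L : ℝ) ^ 2) 0 Λ Λ' ω (nambuXiCT L μ K' k) -
      sliceSymbolFnXi (β * (L : ℝ) ^ 2) 0 Λ Λ' ω (nambuXiCT L μ K k)) F w hw0 hweven Y'
  refine le_trans (Finset.sum_le_sum fun Y _ => mul_le_mul_of_nonneg_left ?_ (norm_nonneg _)) hcols
  have h := klScaleWt_pair_latticeLegPos_le (L := L) (M := M) hβ.le n Y Y'
  simp only [hw]
  exact h

/-! ## §2 `α_w^Δ = 8·novl·T_max` from weighted per-pair increment bounds on adjacent pairs and an overlap count -/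

open Classical in
/-- **Weighted row sums of the slice defect: `α_w^Δ = 8·novl·T_max`** from MOMENT-weighted per-pair increment bounds on adjacent pairs (weight scale
`nw`), the products `F_ω F_{ω′}` vanishing on non-adjacent pairs, and every sector having `≤ novl` neighbours.
[cite: BenfattoGiulianiMastropietro2006, §2.8 (2.81), §3 (3.3)] -/
theorem rowSumWt_sliceCT_sub_le_alpha {β : ℝ} (hβ : 0 < β) (μ : ℝ) (K K' : TrigPolyC4v) (Λ Λ' : ℝ) (nw : ℕ)
    (F : Fin N → FreqMomentum L M → ℂ) (Adj : Fin N → Fin N → Prop) [DecidableRel Adj] {Tmax : ℝ} (hTmax : 0 ≤ Tmax)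
    (hT : ∀ ω ω', Adj ω ω' → ∑ z : TorusSite 1 (2 * M) × TorusSite 2 L,
        (1 + klScale klE0 nw * β / (2 * M) * |(((z.1 0).valMinAbs : ℤ) : ℝ)| + klScale klE0 nw * |(((z.2 0).valMinAbs : ℤ) : ℝ)| +
          klScale klE0 nw * |(((z.2 1).valMinAbs : ℤ) : ℝ)|) *
        ‖∑ q : TorusSite 1 (2 * M) × TorusSite 2 L, (torusChar q.1 z.1 * torusChar q.2 z.2) •
          ((((1 / (β * (L : ℝ) ^ 2) : ℝ) : ℂ) ^ 2 *
            (F ω (⟨(q.1 0).val, ZMod.val_lt (q.1 0)⟩, q.2) * F ω' (⟨(q.1 0).val, ZMod.val_lt (q.1 0)⟩, q.2) *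
              (sliceSymbolFnXi (β * (L : ℝ) ^ 2) 0 Λ Λ' (matsubaraFreq β M ⟨(q.1 0).val, ZMod.val_lt (q.1 0)⟩) (nambuXiCT L μ K' q.2) -
                sliceSymbolFnXi (β * (L : ℝ) ^ 2) 0 Λ Λ' (matsubaraFreq β M ⟨(q.1 0).val, ZMod.val_lt (q.1 0)⟩) (nambuXiCT L μ K q.2)))))‖ ≤
        Tmax)
    (hdisj : ∀ ω ω', ¬ Adj ω ω' → ∀ k : FreqMomentum L M, F ω k * F ω' k = 0)
    {novl : ℕ} (hcard : ∀ ω, (univ.filter fun ω' => Adj ω ω').card ≤ novl) (Y : SpaceTimeIdx L M × SectorLeg N) :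
    ∑ Y' : SpaceTimeIdx L M × SectorLeg N,
        ‖((sectorSubMatrix L M β F).transpose * (hubbardCovSliceCT L M β μ 0 K' Λ Λ' - hubbardCovSliceCT L M β μ 0 K Λ Λ') *
            sectorSubMatrix L M β F) Y Y'‖ *
          klScaleWt L M β nw {latticeLegPos (2 * (2 * M)) Y, latticeLegPos (2 * (2 * M)) Y'} ≤
      8 * (novl * Tmax) := by
  refine (rowSum_klScaleWt_sliceCT_sub_le hβ μ K K' Λ Λ' nw F Y).trans (mul_le_mul_of_nonneg_left ?_ (by norm_num))
  set T : Fin N → Fin N → ℝ := fun ω ω' => ∑ z : TorusSite 1 (2 * M) × TorusSite 2 L,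
    (1 + klScale klE0 nw * β / (2 * M) * |(((z.1 0).valMinAbs : ℤ) : ℝ)| + klScale klE0 nw * |(((z.2 0).valMinAbs : ℤ) : ℝ)| +
      klScale klE0 nw * |(((z.2 1).valMinAbs : ℤ) : ℝ)|) *
    ‖∑ q : TorusSite 1 (2 * M) × TorusSite 2 L, (torusChar q.1 z.1 * torusChar q.2 z.2) •
      ((((1 / (β * (L : ℝ) ^ 2) : ℝ) : ℂ) ^ 2 *
        (F ω (⟨(q.1 0).val, ZMod.val_lt (q.1 0)⟩, q.2) * F ω' (⟨(q.1 0).val, ZMod.val_lt (q.1 0)⟩, q.2) *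
          (sliceSymbolFnXi (β * (L : ℝ) ^ 2) 0 Λ Λ' (matsubaraFreq β M ⟨(q.1 0).val, ZMod.val_lt (q.1 0)⟩) (nambuXiCT L μ K' q.2) -
            sliceSymbolFnXi (β * (L : ℝ) ^ 2) 0 Λ Λ' (matsubaraFreq β M ⟨(q.1 0).val, ZMod.val_lt (q.1 0)⟩) (nambuXiCT L μ K q.2)))))‖
    with hTdef
  have hzero : ∀ ω ω', ¬ Adj ω ω' → T ω ω' = 0 := by
    intro ω ω' h
    rw [hTdef]
    refine Finset.sum_eq_zero fun z _ => ?_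
    have h0 : (∑ q : TorusSite 1 (2 * M) × TorusSite 2 L, (torusChar q.1 z.1 * torusChar q.2 z.2) •
        ((((1 / (β * (L : ℝ) ^ 2) : ℝ) : ℂ) ^ 2 *
          (F ω (⟨(q.1 0).val, ZMod.val_lt (q.1 0)⟩, q.2) * F ω' (⟨(q.1 0).val, ZMod.val_lt (q.1 0)⟩, q.2) *
            (sliceSymbolFnXi (β * (L : ℝ) ^ 2) 0 Λ Λ' (matsubaraFreq β M ⟨(q.1 0).val, ZMod.val_lt (q.1 0)⟩) (nambuXiCT L μ K' q.2) -
              sliceSymbolFnXi (β * (L : ℝ) ^ 2) 0 Λ Λ' (matsubaraFreq β M ⟨(q.1 0).val, ZMod.val_lt (q.1 0)⟩) (nambuXiCT L μ K q.2)))))) = 0 :=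
      Finset.sum_eq_zero fun q _ => by rw [hdisj ω ω' h _, zero_mul, mul_zero, smul_zero]
    rw [h0, norm_zero, mul_zero]
  have hTle : ∀ ω ω', T ω ω' ≤ Tmax := by
    intro ω ω'
    by_cases h : Adj ω ω'
    · exact hT ω ω' h
    · rw [hzero ω ω' h]; exact hTmax
  exact sum_pair_le_of_overlap T Adj hTmax hTle hzero hcard Y.2.1.1

open Classical in
/-- **Weighted column sums of the slice defect: `α_w^Δ = 8·novl·T_max`** (adjacency counted in the first slot).
[cite: BenfattoGiulianiMastropietro2006, §2.8 (2.81)] -/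
theorem colSumWt_sliceCT_sub_le_alpha {β : ℝ} (hβ : 0 < β) (μ : ℝ) (K K' : TrigPolyC4v) (Λ Λ' : ℝ) (nw : ℕ)
    (F : Fin N → FreqMomentum L M → ℂ) (Adj : Fin N → Fin N → Prop) [DecidableRel Adj] {Tmax : ℝ} (hTmax : 0 ≤ Tmax)
    (hT : ∀ ω ω', Adj ω ω' → ∑ z : TorusSite 1 (2 * M) × TorusSite 2 L,
        (1 + klScale klE0 nw * β / (2 * M) * |(((z.1 0).valMinAbs : ℤ) : ℝ)| + klScale klE0 nw * |(((z.2 0).valMinAbs : ℤ) : ℝ)| +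
          klScale klE0 nw * |(((z.2 1).valMinAbs : ℤ) : ℝ)|) *
        ‖∑ q : TorusSite 1 (2 * M) × TorusSite 2 L, (torusChar q.1 z.1 * torusChar q.2 z.2) •
          ((((1 / (β * (L : ℝ) ^ 2) : ℝ) : ℂ) ^ 2 *
            (F ω (⟨(q.1 0).val, ZMod.val_lt (q.1 0)⟩, q.2) * F ω' (⟨(q.1 0).val, ZMod.val_lt (q.1 0)⟩, q.2) *
              (sliceSymbolFnXi (β * (L : ℝ) ^ 2) 0 Λ Λ' (matsubaraFreq β M ⟨(q.1 0).val, ZMod.val_lt (q.1 0)⟩) (nambuXiCT L μ K' q.2) -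
                sliceSymbolFnXi (β * (L : ℝ) ^ 2) 0 Λ Λ' (matsubaraFreq β M ⟨(q.1 0).val, ZMod.val_lt (q.1 0)⟩) (nambuXiCT L μ K q.2)))))‖ ≤
        Tmax)
    (hdisj : ∀ ω ω', ¬ Adj ω ω' → ∀ k : FreqMomentum L M, F ω k * F ω' k = 0)
    {novl : ℕ} (hcard : ∀ ω', (univ.filter fun ω => Adj ω ω').card ≤ novl) (Y' : SpaceTimeIdx L M × SectorLeg N) :
    ∑ Y : SpaceTimeIdx L M × SectorLeg N,
        ‖((sectorSubMatrix L M β F).transpose * (hubbardCovSliceCT L M β μ 0 K' Λ Λ' - hubbardCovSliceCT L M β μ 0 K Λ Λ') *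
            sectorSubMatrix L M β F) Y Y'‖ *
          klScaleWt L M β nw {latticeLegPos (2 * (2 * M)) Y, latticeLegPos (2 * (2 * M)) Y'} ≤
      8 * (novl * Tmax) := by
  refine (colSum_klScaleWt_sliceCT_sub_le hβ μ K K' Λ Λ' nw F Y').trans (mul_le_mul_of_nonneg_left ?_ (by norm_num))
  set T : Fin N → Fin N → ℝ := fun ω ω' => ∑ z : TorusSite 1 (2 * M) × TorusSite 2 L,
    (1 + klScale klE0 nw * β / (2 * M) * |(((z.1 0).valMinAbs : ℤ) : ℝ)| + klScale klE0 nw * |(((z.2 0).valMinAbs : ℤ) : ℝ)| +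
      klScale klE0 nw * |(((z.2 1).valMinAbs : ℤ) : ℝ)|) *
    ‖∑ q : TorusSite 1 (2 * M) × TorusSite 2 L, (torusChar q.1 z.1 * torusChar q.2 z.2) •
      ((((1 / (β * (L : ℝ) ^ 2) : ℝ) : ℂ) ^ 2 *
        (F ω (⟨(q.1 0).val, ZMod.val_lt (q.1 0)⟩, q.2) * F ω' (⟨(q.1 0).val, ZMod.val_lt (q.1 0)⟩, q.2) *
          (sliceSymbolFnXi (β * (L : ℝ) ^ 2) 0 Λ Λ' (matsubaraFreq β M ⟨(q.1 0).val, ZMod.val_lt (q.1 0)⟩) (nambuXiCT L μ K' q.2) -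
            sliceSymbolFnXi (β * (L : ℝ) ^ 2) 0 Λ Λ' (matsubaraFreq β M ⟨(q.1 0).val, ZMod.val_lt (q.1 0)⟩) (nambuXiCT L μ K q.2)))))‖
    with hTdef
  have hzero : ∀ ω ω', ¬ Adj ω ω' → T ω ω' = 0 := by
    intro ω ω' h
    rw [hTdef]
    refine Finset.sum_eq_zero fun z _ => ?_
    have h0 : (∑ q : TorusSite 1 (2 * M) × TorusSite 2 L, (torusChar q.1 z.1 * torusChar q.2 z.2) •
        ((((1 / (β * (L : ℝ) ^ 2) : ℝ) : ℂ) ^ 2 *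
          (F ω (⟨(q.1 0).val, ZMod.val_lt (q.1 0)⟩, q.2) * F ω' (⟨(q.1 0).val, ZMod.val_lt (q.1 0)⟩, q.2) *
            (sliceSymbolFnXi (β * (L : ℝ) ^ 2) 0 Λ Λ' (matsubaraFreq β M ⟨(q.1 0).val, ZMod.val_lt (q.1 0)⟩) (nambuXiCT L μ K' q.2) -
              sliceSymbolFnXi (β * (L : ℝ) ^ 2) 0 Λ Λ' (matsubaraFreq β M ⟨(q.1 0).val, ZMod.val_lt (q.1 0)⟩) (nambuXiCT L μ K q.2)))))) = 0 :=
      Finset.sum_eq_zero fun q _ => by rw [hdisj ω ω' h _, zero_mul, mul_zero, smul_zero]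
    rw [h0, norm_zero, mul_zero]
  have hTle : ∀ ω ω', T ω ω' ≤ Tmax := by
    intro ω ω'
    by_cases h : Adj ω ω'
    · exact hT ω ω' h
    · rw [hzero ω ω' h]; exact hTmax
  exact sum_pair_le_of_overlap' T Adj hTmax hTle hzero hcard Y'.2.1.1

end Generic

/-! ## §3 The fat family on any frame: `α_w^Δ = 72·D·T_max` from a uniform rate-weighted per-pair increment bound -/

section Fat

variable {L M : ℕ} [NeZero L] [NeZero M]

/-- **`hrow_w` of the slice defect for the fat family from a uniform rate-weighted per-pair increment bound**: with the fat family
`F̃ = bgmFatMultiplier … (nambuXiCT L μ K_F) (m+1)` on ANY frame `K_F`, if every pair `(ω, ω′)` obeys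
`Σ_z (1 + s₀|z̃₁| + s₁|z̃₂|₁)·‖S[(βL²)⁻²F̃_ωF̃_{ω′}(Ψ̂[K′] − Ψ̂[K])]‖(z) ≤ T_max` and the weight scale `nw` is dominated by the rates
(`Λ_{nw}β/(2M) ≤ D s₀`, `Λ_{nw} ≤ D s₁`, `1 ≤ D`), then
`Σ_{Y′} ‖(S(F̃)ᵀ (C^{K′}_{(Λ,Λ′]} − C^{K}_{(Λ,Λ′]}) S(F̃)) Y Y′‖·klScaleWt nw {pos Y, pos Y′} ≤ 8·(9·(D·T_max))`.
[cite: BenfattoGiulianiMastropietro2006, §2.8 (2.81), §3 (3.3)] -/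
theorem rowSumWt_sliceCT_sub_bgmFat_le_of_pairBound {β : ℝ} (hβ : 0 < β) (μ : ℝ) (K K' KF : TrigPolyC4v) (Λ Λ' e₀ : ℝ) (m nw : ℕ)
    {s₀ s₁ D Tmax : ℝ} (hD : 1 ≤ D) (hd₀ : klScale klE0 nw * β / (2 * M) ≤ D * s₀)
    (hd₁ : klScale klE0 nw ≤ D * s₁) (hTmax : 0 ≤ Tmax)
    (hT : ∀ ω ω' : Fin (sectorCount (m + 1)), ∑ z : TorusSite 1 (2 * M) × TorusSite 2 L,
        (1 + s₀ * |(((z.1 0).valMinAbs : ℤ) : ℝ)| + s₁ * |(((z.2 0).valMinAbs : ℤ) : ℝ)| + s₁ * |(((z.2 1).valMinAbs : ℤ) : ℝ)|) *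
        ‖∑ q : TorusSite 1 (2 * M) × TorusSite 2 L, (torusChar q.1 z.1 * torusChar q.2 z.2) •
          ((((1 / (β * (L : ℝ) ^ 2) : ℝ) : ℂ) ^ 2 *
            (bgmFatMultiplier L M e₀ β (nambuXiCT L μ KF) (m + 1) ω (⟨(q.1 0).val, ZMod.val_lt (q.1 0)⟩, q.2) *
              bgmFatMultiplier L M e₀ β (nambuXiCT L μ KF) (m + 1) ω' (⟨(q.1 0).val, ZMod.val_lt (q.1 0)⟩, q.2) *
              (sliceSymbolFnXi (β * (L : ℝ) ^ 2) 0 Λ Λ' (matsubaraFreq β M ⟨(q.1 0).val, ZMod.val_lt (q.1 0)⟩) (nambuXiCT L μ K' q.2) -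
                sliceSymbolFnXi (β * (L : ℝ) ^ 2) 0 Λ Λ' (matsubaraFreq β M ⟨(q.1 0).val, ZMod.val_lt (q.1 0)⟩) (nambuXiCT L μ K q.2)))))‖ ≤
        Tmax)
    (Y : SpaceTimeIdx L M × SectorLeg (sectorCount (m + 1))) :
    ∑ Y' : SpaceTimeIdx L M × SectorLeg (sectorCount (m + 1)),
        ‖((sectorSubMatrix L M β (bgmFatMultiplier L M e₀ β (nambuXiCT L μ KF) (m + 1))).transpose *
            (hubbardCovSliceCT L M β μ 0 K' Λ Λ' - hubbardCovSliceCT L M β μ 0 K Λ Λ') *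
            sectorSubMatrix L M β (bgmFatMultiplier L M e₀ β (nambuXiCT L μ KF) (m + 1))) Y Y'‖ *
          klScaleWt L M β nw {latticeLegPos (2 * (2 * M)) Y, latticeLegPos (2 * (2 * M)) Y'} ≤
      8 * ((9 : ℕ) * (D * Tmax)) := by
  classical
  have hD0 : 0 ≤ D := zero_le_one.trans hD
  refine rowSumWt_sliceCT_sub_le_alpha hβ μ K K' Λ Λ' nw _
    (fun ω ω' => ∃ k : FreqMomentum L M, bgmFatMultiplier L M e₀ β (nambuXiCT L μ KF) (m + 1) ω k *
      bgmFatMultiplier L M e₀ β (nambuXiCT L μ KF) (m + 1) ω' k ≠ 0) (by positivity) (fun ω ω' _ => ?_) (fun ω ω' h k => ?_)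
    (fun ω => card_overlap_bgmFat_le_nine (L := L) (M := M) (K := KF) (μ := μ) (e₀ := e₀) (β := β) m ω) Y
  · calc _ ≤ ∑ z : TorusSite 1 (2 * M) × TorusSite 2 L,
          (D * (1 + s₀ * |(((z.1 0).valMinAbs : ℤ) : ℝ)| + s₁ * |(((z.2 0).valMinAbs : ℤ) : ℝ)| + s₁ * |(((z.2 1).valMinAbs : ℤ) : ℝ)|)) *
          ‖∑ q : TorusSite 1 (2 * M) × TorusSite 2 L, (torusChar q.1 z.1 * torusChar q.2 z.2) •
            ((((1 / (β * (L : ℝ) ^ 2) : ℝ) : ℂ) ^ 2 *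
              (bgmFatMultiplier L M e₀ β (nambuXiCT L μ KF) (m + 1) ω (⟨(q.1 0).val, ZMod.val_lt (q.1 0)⟩, q.2) *
                bgmFatMultiplier L M e₀ β (nambuXiCT L μ KF) (m + 1) ω' (⟨(q.1 0).val, ZMod.val_lt (q.1 0)⟩, q.2) *
                (sliceSymbolFnXi (β * (L : ℝ) ^ 2) 0 Λ Λ' (matsubaraFreq β M ⟨(q.1 0).val, ZMod.val_lt (q.1 0)⟩) (nambuXiCT L μ K' q.2) -
                  sliceSymbolFnXi (β * (L : ℝ) ^ 2) 0 Λ Λ' (matsubaraFreq β M ⟨(q.1 0).val, ZMod.val_lt (q.1 0)⟩)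
                    (nambuXiCT L μ K q.2)))))‖ :=
          sum_le_sum fun z _ => mul_le_mul_of_nonneg_right (momentWt_le_mul_rateWt hD hd₀ hd₁ z) (norm_nonneg _)
      _ = D * ∑ z : TorusSite 1 (2 * M) × TorusSite 2 L,
          (1 + s₀ * |(((z.1 0).valMinAbs : ℤ) : ℝ)| + s₁ * |(((z.2 0).valMinAbs : ℤ) : ℝ)| + s₁ * |(((z.2 1).valMinAbs : ℤ) : ℝ)|) *
          ‖∑ q : TorusSite 1 (2 * M) × TorusSite 2 L, (torusChar q.1 z.1 * torusChar q.2 z.2) •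
            ((((1 / (β * (L : ℝ) ^ 2) : ℝ) : ℂ) ^ 2 *
              (bgmFatMultiplier L M e₀ β (nambuXiCT L μ KF) (m + 1) ω (⟨(q.1 0).val, ZMod.val_lt (q.1 0)⟩, q.2) *
                bgmFatMultiplier L M e₀ β (nambuXiCT L μ KF) (m + 1) ω' (⟨(q.1 0).val, ZMod.val_lt (q.1 0)⟩, q.2) *
                (sliceSymbolFnXi (β * (L : ℝ) ^ 2) 0 Λ Λ' (matsubaraFreq β M ⟨(q.1 0).val, ZMod.val_lt (q.1 0)⟩) (nambuXiCT L μ K' q.2) -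
                  sliceSymbolFnXi (β * (L : ℝ) ^ 2) 0 Λ Λ' (matsubaraFreq β M ⟨(q.1 0).val, ZMod.val_lt (q.1 0)⟩)
                    (nambuXiCT L μ K q.2)))))‖ := by
          rw [mul_sum]; exact sum_congr rfl fun z _ => by ring
      _ ≤ D * Tmax := mul_le_mul_of_nonneg_left (hT ω ω') hD0
  · by_contra hk
    exact h ⟨k, hk⟩

/-- **`hcol_w` of the slice defect for the fat family from a uniform rate-weighted per-pair increment bound**: the column twin.
[cite: BenfattoGiulianiMastropietro2006, §2.8 (2.81)] -/
theorem colSumWt_sliceCT_sub_bgmFat_le_of_pairBound {β : ℝ} (hβ : 0 < β) (μ : ℝ) (K K' KF : TrigPolyC4v) (Λ Λ' e₀ : ℝ) (m nw : ℕ)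
    {s₀ s₁ D Tmax : ℝ} (hD : 1 ≤ D) (hd₀ : klScale klE0 nw * β / (2 * M) ≤ D * s₀)
    (hd₁ : klScale klE0 nw ≤ D * s₁) (hTmax : 0 ≤ Tmax)
    (hT : ∀ ω ω' : Fin (sectorCount (m + 1)), ∑ z : TorusSite 1 (2 * M) × TorusSite 2 L,
        (1 + s₀ * |(((z.1 0).valMinAbs : ℤ) : ℝ)| + s₁ * |(((z.2 0).valMinAbs : ℤ) : ℝ)| + s₁ * |(((z.2 1).valMinAbs : ℤ) : ℝ)|) *
        ‖∑ q : TorusSite 1 (2 * M) × TorusSite 2 L, (torusChar q.1 z.1 * torusChar q.2 z.2) •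
          ((((1 / (β * (L : ℝ) ^ 2) : ℝ) : ℂ) ^ 2 *
            (bgmFatMultiplier L M e₀ β (nambuXiCT L μ KF) (m + 1) ω (⟨(q.1 0).val, ZMod.val_lt (q.1 0)⟩, q.2) *
              bgmFatMultiplier L M e₀ β (nambuXiCT L μ KF) (m + 1) ω' (⟨(q.1 0).val, ZMod.val_lt (q.1 0)⟩, q.2) *
              (sliceSymbolFnXi (β * (L : ℝ) ^ 2) 0 Λ Λ' (matsubaraFreq β M ⟨(q.1 0).val, ZMod.val_lt (q.1 0)⟩) (nambuXiCT L μ K' q.2) -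
                sliceSymbolFnXi (β * (L : ℝ) ^ 2) 0 Λ Λ' (matsubaraFreq β M ⟨(q.1 0).val, ZMod.val_lt (q.1 0)⟩) (nambuXiCT L μ K q.2)))))‖ ≤
        Tmax)
    (Y' : SpaceTimeIdx L M × SectorLeg (sectorCount (m + 1))) :
    ∑ Y : SpaceTimeIdx L M × SectorLeg (sectorCount (m + 1)),
        ‖((sectorSubMatrix L M β (bgmFatMultiplier L M e₀ β (nambuXiCT L μ KF) (m + 1))).transpose *
            (hubbardCovSliceCT L M β μ 0 K' Λ Λ' - hubbardCovSliceCT L M β μ 0 K Λ Λ') *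
            sectorSubMatrix L M β (bgmFatMultiplier L M e₀ β (nambuXiCT L μ KF) (m + 1))) Y Y'‖ *
          klScaleWt L M β nw {latticeLegPos (2 * (2 * M)) Y, latticeLegPos (2 * (2 * M)) Y'} ≤
      8 * ((9 : ℕ) * (D * Tmax)) := by
  classical
  have hD0 : 0 ≤ D := zero_le_one.trans hD
  refine colSumWt_sliceCT_sub_le_alpha hβ μ K K' Λ Λ' nw _
    (fun ω ω' => ∃ k : FreqMomentum L M, bgmFatMultiplier L M e₀ β (nambuXiCT L μ KF) (m + 1) ω k *
      bgmFatMultiplier L M e₀ β (nambuXiCT L μ KF) (m + 1) ω' k ≠ 0) (by positivity) (fun ω ω' _ => ?_) (fun ω ω' h k => ?_)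
    (fun ω' => card_overlap_bgmFat_le_nine' (L := L) (M := M) (K := KF) (μ := μ) (e₀ := e₀) (β := β) m ω') Y'
  · calc _ ≤ ∑ z : TorusSite 1 (2 * M) × TorusSite 2 L,
          (D * (1 + s₀ * |(((z.1 0).valMinAbs : ℤ) : ℝ)| + s₁ * |(((z.2 0).valMinAbs : ℤ) : ℝ)| + s₁ * |(((z.2 1).valMinAbs : ℤ) : ℝ)|)) *
          ‖∑ q : TorusSite 1 (2 * M) × TorusSite 2 L, (torusChar q.1 z.1 * torusChar q.2 z.2) •
            ((((1 / (β * (L : ℝ) ^ 2) : ℝ) : ℂ) ^ 2 *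
              (bgmFatMultiplier L M e₀ β (nambuXiCT L μ KF) (m + 1) ω (⟨(q.1 0).val, ZMod.val_lt (q.1 0)⟩, q.2) *
                bgmFatMultiplier L M e₀ β (nambuXiCT L μ KF) (m + 1) ω' (⟨(q.1 0).val, ZMod.val_lt (q.1 0)⟩, q.2) *
                (sliceSymbolFnXi (β * (L : ℝ) ^ 2) 0 Λ Λ' (matsubaraFreq β M ⟨(q.1 0).val, ZMod.val_lt (q.1 0)⟩) (nambuXiCT L μ K' q.2) -
                  sliceSymbolFnXi (β * (L : ℝ) ^ 2) 0 Λ Λ' (matsubaraFreq β M ⟨(q.1 0).val, ZMod.val_lt (q.1 0)⟩)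
                    (nambuXiCT L μ K q.2)))))‖ :=
          sum_le_sum fun z _ => mul_le_mul_of_nonneg_right (momentWt_le_mul_rateWt hD hd₀ hd₁ z) (norm_nonneg _)
      _ = D * ∑ z : TorusSite 1 (2 * M) × TorusSite 2 L,
          (1 + s₀ * |(((z.1 0).valMinAbs : ℤ) : ℝ)| + s₁ * |(((z.2 0).valMinAbs : ℤ) : ℝ)| + s₁ * |(((z.2 1).valMinAbs : ℤ) : ℝ)|) *
          ‖∑ q : TorusSite 1 (2 * M) × TorusSite 2 L, (torusChar q.1 z.1 * torusChar q.2 z.2) •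
            ((((1 / (β * (L : ℝ) ^ 2) : ℝ) : ℂ) ^ 2 *
              (bgmFatMultiplier L M e₀ β (nambuXiCT L μ KF) (m + 1) ω (⟨(q.1 0).val, ZMod.val_lt (q.1 0)⟩, q.2) *
                bgmFatMultiplier L M e₀ β (nambuXiCT L μ KF) (m + 1) ω' (⟨(q.1 0).val, ZMod.val_lt (q.1 0)⟩, q.2) *
                (sliceSymbolFnXi (β * (L : ℝ) ^ 2) 0 Λ Λ' (matsubaraFreq β M ⟨(q.1 0).val, ZMod.val_lt (q.1 0)⟩) (nambuXiCT L μ K' q.2) -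
                  sliceSymbolFnXi (β * (L : ℝ) ^ 2) 0 Λ Λ' (matsubaraFreq β M ⟨(q.1 0).val, ZMod.val_lt (q.1 0)⟩)
                    (nambuXiCT L μ K q.2)))))‖ := by
          rw [mul_sum]; exact sum_congr rfl fun z _ => by ring
      _ ≤ D * Tmax := mul_le_mul_of_nonneg_left (hT ω ω') hD0
  · by_contra hk
    exact h ⟨k, hk⟩

end Fat

/-! ## §4 Entry sup (bracket (a)) and plain rows from the weighted rows -/

section Entry

variable {L M N : ℕ} [NeZero L] [NeZero M] {α : Type*} [Fintype α]

omit [NeZero L] [NeZero M] in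
/-- **Plain row sums from weighted ones** (`1 ≤ klScaleWt`): if `Σ_{Y′} ‖D Y Y′‖·klScaleWt nw {pos Y, pos Y′} ≤ B` then `Σ_{Y′} ‖D Y Y′‖ ≤ B`. [folklore] -/
theorem rowSum_norm_le_of_rowSumWt (β : ℝ) (nw : ℕ) (D : α → α → ℂ) (pos : α → ZMod (2 * (2 * M)) × TorusSite 2 L) (Y : α) {B : ℝ}
    (h : ∑ Y' : α, ‖D Y Y'‖ * klScaleWt L M β nw {pos Y, pos Y'} ≤ B) : ∑ Y' : α, ‖D Y Y'‖ ≤ B := by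
  refine le_trans (Finset.sum_le_sum fun Y' _ => ?_) h
  exact le_mul_of_one_le_right (norm_nonneg _) (one_le_klScaleWt L M β nw _)

omit [NeZero L] [NeZero M] in
/-- **Plain column sums from weighted ones** (`1 ≤ klScaleWt`). [folklore] -/
theorem colSum_norm_le_of_colSumWt (β : ℝ) (nw : ℕ) (D : α → α → ℂ) (pos : α → ZMod (2 * (2 * M)) × TorusSite 2 L) (Y' : α) {B : ℝ}
    (h : ∑ Y : α, ‖D Y Y'‖ * klScaleWt L M β nw {pos Y, pos Y'} ≤ B) : ∑ Y : α, ‖D Y Y'‖ ≤ B := by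
  refine le_trans (Finset.sum_le_sum fun Y _ => ?_) h
  exact le_mul_of_one_le_right (norm_nonneg _) (one_le_klScaleWt L M β nw _)

omit [NeZero L] [NeZero M] in
/-- **Entry sup from weighted row sums** (bracket (a) of «MISMATCH-SLICE»): if `Σ_{Y′} ‖D Y Y′‖·klScaleWt nw {pos Y, pos Y′} ≤ B` for every `Y`
then `‖D Y Y′‖ ≤ B` for all `Y, Y′`. [folklore] -/
theorem norm_apply_le_of_rowSumWt (β : ℝ) (nw : ℕ) (D : α → α → ℂ) (pos : α → ZMod (2 * (2 * M)) × TorusSite 2 L) {B : ℝ}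
    (h : ∀ Y : α, ∑ Y' : α, ‖D Y Y'‖ * klScaleWt L M β nw {pos Y, pos Y'} ≤ B) (Y Y' : α) : ‖D Y Y'‖ ≤ B := by
  classical
  have hrow := rowSum_norm_le_of_rowSumWt (L := L) (M := M) β nw D pos Y (h Y)
  exact le_trans (Finset.single_le_sum (f := fun Y' => ‖D Y Y'‖) (fun _ _ => norm_nonneg _) (Finset.mem_univ Y')) hrow

end Entry

end Summit.HubbardSuperconductivity.HubbardSuperconductivity.Theorems.TorusFourierL2

end
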